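import Summits.BirchSwinnertonDyer.BirchSwinnertonDyer.Theorems.GenusKolyvaginAtTwoPowDvdShaCardAtTwoRTKolyvaginSuppliesOfSockets
import HarnessLib

/-!
# Route `GenusKolyvaginAtTwo`, LINE 18 `plus_descent` v5.3 (crux L_T `PowDvdShaCardAtTwoRT`, stmt-BirchSwinnertonDyer-23299 (rev-32 renumbering of
# 23242)) — STUB KS FROM STUB W-UP, BY NAME: the registered text of `stub_kolyvaginSystemAtTwo` (v5.3) follows from the registered text of
# `stub_grossWitnessAtTwo` (v5.3) and the landed engine

Seat `bsd-line-gk2-p3` g24 (PROVER seat 3/3, cell `bsd-f1-sign2`), `--supports stmt-BirchSwinnertonDyer-23299` (helper; closes nothing: W-UP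
stays open, and the crux L_T / BSD are NOT proved by any of this).

WHAT.  `kolyvaginSystemAtTwo_of_grossWitnessAtTwo : <W-UP v5.3 text> → <KS v5.3 text>` — the two statements VERBATIM (with the skeleton-local `CyclicFixedPartOfNegDisc` unfolded to its
defining text) from the registered skeleton `Cruxes/PowDvdShaCardAtTwoRT/Lines/plus_descent.lean` (LEAD gk2-p1 g18, re-registered 17:32Z), so that the skeleton's KS stub closes by
`exact kolyvaginSystemAtTwo_of_grossWitnessAtTwo stub_grossWitnessAtTwo` the hour W-UP lands (or becomes `exact` under the pen's option (β″)).
HOW.  Instantiate this seat's composition `kolyvaginSuppliesAtTwo_of_grossWitness_onHabitat` (`…RTKolyvaginSuppliesOfSockets`, p735895: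
gk2-p2 g19's assembly `kolyvaginSuppliesAtTwo_of_deepSwap` over hbot := `TransverseValue.hbot_socket_margin_onHabitat_of_three_le` (gk2-p5 g24 +
gk2-p3 g24 hTr), hswap := LEAD's `deepSwap_socket`, hK := gk2-p5's `hK_socket_margin`, (NPh) discharged at the multiplicative place) at level
`L := 2M₀ + 12`, depth `k := 1`, with the Gross witness delivered by W-UP.  KS's own (NPh) binder and the `B ≤ 1` binder are passed to W-UP / unused.
Displayed residuals of KS after this file: NONE beyond its own antecedents (Q2 = `KolyvaginRelationAtTwo`) and stub W-UP.

References: [McCallumLMS1991] §5 Prop. 5.2, Lemma 5.3, Thm. 5.4; [Kolyvagin1991MathAnn] §2 Thm. 2.1–2.2; [GrossLMS1991] §3 (3.1)–(3.3), Prop. 3.7;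
[Howard2004HeegnerKolyvagin] Lemma 2.7.3; [LawsonWuthrich2016] §7.1.
-/

set_option autoImplicit false
-- the Theorems namespace of this sub repeats the summit name by design (D-0017 nested layout)
set_option linter.dupNamespace false

noncomputable section

open scoped Classical

namespace Summit.BirchSwinnertonDyer.BirchSwinnertonDyer.Theorems.GenusExact.PlusDescent

open WeierstrassCurve NumberField IsDedekindDomain Field
open Literature.NumberTheory.GaloisRepresentations Literature.NumberTheory.EllipticCurves
open Literature.NumberTheory
open Summit.BirchSwinnertonDyer.BirchSwinnertonDyer.Theses.GenusKolyvaginAtTwo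

/-- **STUB KS ⟸ STUB W-UP (LINE 18 v5.3 texts, VERBATIM).**  On L's frame (cut habitat: an odd place `v ∣ N` of multiplicative reduction; `Δ < 0`;
`K` imaginary quadratic, `d_K` odd `≠ −3`, Heegner, the two non-square clauses; 2-adic tower onto; the Heegner datum `d₁` with `2^M₀ ∥ P(1)`; the
crux's shallow witness; a twin `Wd` with `ord₂ C(Wd) ≤ 1`): if the shallow witness upgrades to a level-`2` GROSS witness of index `≥ 2` (W-UP), then
for every non-trivial `τ ∈ Gal(K/ℚ)` the Kolyvagin system of KS exists — at level `L = 2M₀ + 12` with margin `k = 1`, by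
`kolyvaginSuppliesAtTwo_of_grossWitness_onHabitat`.  [cite: McCallumLMS1991, §5 Prop. 5.2, Thm. 5.4] [cite: Kolyvagin1991MathAnn, §2 Thm. 2.1–2.2]
[cite: GrossLMS1991, §3 (3.3), Prop. 3.7] -/
theorem kolyvaginSystemAtTwo_of_grossWitnessAtTwo
    (hWUP : PubInputsAtTwo → KolyvaginRelationAtTwo → EquivariantChebotarevAtTwoR → (∀ (W : WeierstrassCurve ℚ) [W.IsElliptic], W.Δ < 0 → ∀ (c₀ : Field.absoluteGaloisGroup ℚ), Literature.NumberTheory.GaloisRepresentations.IsComplexConjugation (Rat.castHom ℝ) c₀ → ∀ (M : ℕ), ∃ P : W.geomTorsion ((2 ^ M : ℕ) : ℤ), addOrderOf P = 2 ^ M ∧ ∀ Q : W.geomTorsion ((2 ^ M : ℕ) : ℤ), c₀ • Q = Q ↔ Q ∈ AddSubgroup.zmultiples P) → ∀ (W : WeierstrassCurve ℚ) [W.IsElliptic] [W.IsGloballyMinimal] [NeZero (W.conductorNorm ℤ)], ¬ W.HasCM → Odd W.tamagawaProduct → ∀ (v : IsDedekindDomain.HeightOneSpectrum (NumberField.RingOfIntegers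 ℚ)), ((2 : ℕ) : NumberField.RingOfIntegers ℚ) ∉ v.asIdeal → ((W.conductorNorm ℤ : ℕ) : NumberField.RingOfIntegers ℚ) ∈ v.asIdeal → W.HasMultiplicativeReductionAt v → W.Δ < 0 → ∀ (K : Type) [Field K] [NumberField K], Literature.NumberTheory.EllipticCurves.IsImaginaryQuadratic K → Odd (NumberField.discr K) → NumberField.discr K ≠ -3 → Literature.NumberTheory.EllipticCurves.SatisfiesHeegnerHypothesis (W.conductorNorm ℤ) K → ¬ IsSquare ((NumberField.discr K : ℚ) * -|W.Δ|) → ¬ IsSquare ((NumberField.discr K : ℚ) * (-(2 * |W.Δ|))) → (∀ n : ℕ, 0 < n → W.HasSurjectiveModNGaloisRep ((2 : ℤ) ^ n)) → ∀ (Dt : Literature.NumberTheory.EllipticCurves.ModularForms.ModularParametrizationData W (W.conductorNorm ℤ)) (β : ℤ) (ι : K →+* ℂ) (d₁ : Literature.NumberTheory.EllipticCurves.KolyvaginHeegnerData Dt β ι 1), ¬ IsOfFinAddOrder d₁.derivedPoint → ∀ (M₀ : ℕ), (∃ Q : (W.baseChange (Literature.NumberTheory.EllipticCurves.ringClassField K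 ι 1)).toAffine.Point, ((2 ^ M₀ : ℕ) : ℤ) • Q = d₁.derivedPoint) → (¬ ∃ Q : (W.baseChange (Literature.NumberTheory.EllipticCurves.ringClassField K ι 1)).toAffine.Point, ((2 ^ (M₀ + 1) : ℕ) : ℤ) • Q = d₁.derivedPoint) → ∀ (n : ℕ) (d : Literature.NumberTheory.EllipticCurves.KolyvaginHeegnerData Dt β ι n), Squarefree n → (∀ ℓ ∈ n.primeFactors, Literature.NumberTheory.EllipticCurves.Zhang2014.IsKolyvaginPrime (W.conductorNorm ℤ) W K 2 ℓ) → (¬ ∃ Q : (W.baseChange (Literature.NumberTheory.EllipticCurves.ringClassField K ι n)).toAffine.Point, (2 : ℤ) • Q = d.derivedPoint) → ∀ (Wd : WeierstrassCurve ℚ) [Wd.IsElliptic] [Wd.IsGloballyMinimal], (∃ C : WeierstrassCurve.VariableChange ℚ, C • W.quadraticTwist (NumberField.discr K : ℚ) = Wd) → padicValNat 2 Wd.tamagawaProduct ≤ 1 → ∃ (n₀ : ℕ) (e₀ : KolyvaginHeegnerData Dt β ι n₀), Squarefree n₀ ∧ (∀ q ∈ n₀.primeFactors, Zhang2014.IsKolyvaginPrime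 (W.conductorNorm ℤ) W K 2 q ∧ 2 ≤ Zhang2014.kolyvaginIndex W 2 q ∧ FrobEqFrobInfty W K 2 q) ∧ ¬ ∃ Q : (W.baseChange (Literature.NumberTheory.EllipticCurves.ringClassField K ι n₀)).toAffine.Point, (2 : ℤ) • Q = e₀.derivedPoint) :
    PubInputsAtTwo → KolyvaginRelationAtTwo → EquivariantChebotarevAtTwoR → (∀ (W : WeierstrassCurve ℚ) [W.IsElliptic], W.Δ < 0 → ∀ (c₀ : Field.absoluteGaloisGroup ℚ), Literature.NumberTheory.GaloisRepresentations.IsComplexConjugation (Rat.castHom ℝ) c₀ → ∀ (M : ℕ), ∃ P : W.geomTorsion ((2 ^ M : ℕ) : ℤ), addOrderOf P = 2 ^ M ∧ ∀ Q : W.geomTorsion ((2 ^ M : ℕ) : ℤ), c₀ • Q = Q ↔ Q ∈ AddSubgroup.zmultiples P) → ∀ (W : WeierstrassCurve ℚ) [W.IsElliptic] [W.IsGloballyMinimal] [NeZero (W.conductorNorm ℤ)], ¬ W.HasCM → Odd W.tamagawaProduct → ∀ (v : IsDedekindDomain.HeightOneSpectrum (NumberField.RingOfIntegers ℚ)), ((2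 : ℕ) : NumberField.RingOfIntegers ℚ) ∉ v.asIdeal → ((W.conductorNorm ℤ : ℕ) : NumberField.RingOfIntegers ℚ) ∈ v.asIdeal → W.HasMultiplicativeReductionAt v → W.Δ < 0 → ∀ (K : Type) [Field K] [NumberField K], Literature.NumberTheory.EllipticCurves.IsImaginaryQuadratic K → Odd (NumberField.discr K) → NumberField.discr K ≠ -3 → Literature.NumberTheory.EllipticCurves.SatisfiesHeegnerHypothesis (W.conductorNorm ℤ) K → ¬ IsSquare ((NumberField.discr K : ℚ) * -|W.Δ|) → ¬ IsSquare ((NumberField.discr K : ℚ) * (-(2 * |W.Δ|))) → (∀ n : ℕ, 0 < n → W.HasSurjectiveModNGaloisRep ((2 : ℤ) ^ n)) → ∀ (Dt : Literature.NumberTheory.EllipticCurves.ModularForms.ModularParametrizationData W (W.conductorNorm ℤ)) (β : ℤ) (ι : K →+* ℂ) (d₁ : Literature.NumberTheory.EllipticCurves.KolyvaginHeegnerData Dt β ι 1), ¬ IsOfFinAddOrder d₁.derivedPoint → ∀ (M₀ : ℕ), (∃ Q : (W.baseChange (Literature.NumberTheory.EllipticCurves.ringClassField K ι 1)).toAffine.Point,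 ((2 ^ M₀ : ℕ) : ℤ) • Q = d₁.derivedPoint) → (¬ ∃ Q : (W.baseChange (Literature.NumberTheory.EllipticCurves.ringClassField K ι 1)).toAffine.Point, ((2 ^ (M₀ + 1) : ℕ) : ℤ) • Q = d₁.derivedPoint) → ∀ (n : ℕ) (d : Literature.NumberTheory.EllipticCurves.KolyvaginHeegnerData Dt β ι n), Squarefree n → (∀ ℓ ∈ n.primeFactors, Literature.NumberTheory.EllipticCurves.Zhang2014.IsKolyvaginPrime (W.conductorNorm ℤ) W K 2 ℓ) → (¬ ∃ Q : (W.baseChange (Literature.NumberTheory.EllipticCurves.ringClassField K ι n)).toAffine.Point, (2 : ℤ) • Q = d.derivedPoint) → ∀ (Wd : WeierstrassCurve ℚ) [Wd.IsElliptic] [Wd.IsGloballyMinimal], (∃ C : WeierstrassCurve.VariableChange ℚ, C • W.quadraticTwist (NumberField.discr K : ℚ) = Wd) → padicValNat 2 Wd.tamagawaProduct ≤ 1 → (∀ (Mlev : ℕ), 1 ≤ Mlev → ∀ z : galH1Torsion (W.baseChange K) ((2 ^ Mlev : ℕ) : ℤ), (∀ ρ ∈ torsionFixing (W.baseChange K)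 ((2 ^ Mlev : ℕ) : ℤ), h1Eval (W.baseChange K) ((2 ^ Mlev : ℕ) : ℤ) z ρ = 0) → (∀ w : IsDedekindDomain.HeightOneSpectrum (NumberField.RingOfIntegers K), ((2 * W.conductorNorm ℤ : ℕ) : NumberField.RingOfIntegers K) ∈ w.asIdeal → z ∈ selmerLocalKer (W.baseChange K) (w.adicCompletion K) ((2 ^ Mlev : ℕ) : ℤ)) → z = 0) → ∀ τ : K ≃ₐ[ℚ] K, τ ≠ 1 → ∃ (L R : ℕ) (Mr : ℕ → ℕ), M₀ + 1 ≤ L ∧ (∀ j, Mr (j + 1) ≤ Mr j) ∧ Mr 0 = M₀ ∧ Mr R = 0 ∧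
      (∀ m : ℕ, Mr (2 * m + 1) < Mr (2 * m) →
        ∀ (i : ℕ) (u : Fin i → galH1Torsion (W.baseChange K) ((2 ^ L : ℕ) : ℤ)), i ≤ 2 * m + 1 →
        (∀ j, u j ∈ selmerGroup (W.baseChange K) ((2 ^ L : ℕ) : ℤ) ∧
          conjAct W τ ((2 ^ L : ℕ) : ℤ) (u j) = W.rootNumber • u j) →
        ∃ (n : ℕ) (_ : Squarefree n)
          (_ : ∀ ℓ ∈ n.primeFactors, Zhang2014.IsKolyvaginPrime (W.conductorNorm ℤ) W K 2 ℓ ∧ L ≤ Zhang2014.kolyvaginIndex W 2 ℓ)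
          (d : KolyvaginHeegnerData Dt β ι n),
          (∀ ℓ ∈ n.primeFactors, ∀ e : KolyvaginHeegnerData Dt β ι (n / ℓ),
            ((2 ^ (L - Mr (2 * m)) : ℕ) : ℤ) • e.kolyvaginClass Nat.prime_two L = 0) ∧
          addOrderOf (d.kolyvaginClass Nat.prime_two L) = 2 ^ (L - Mr (2 * m + 1)) ∧
          -W.rootNumber * (-1) ^ n.primeFactors.card = W.rootNumber ∧
          Disjoint (AddSubgroup.zmultiples (((2 ^ (L - Mr (2 * m)) : ℕ) : ℤ) • d.kolyvaginClass Nat.prime_two L))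
            (AddSubgroup.closure (Set.range u))) ∧
      (∀ m : ℕ, Mr (2 * m + 2) < Mr (2 * m + 1) →
        ∀ (i : ℕ) (u : Fin i → galH1Torsion (W.baseChange K) ((2 ^ L : ℕ) : ℤ)), i ≤ 2 * m + 1 →
        (∀ j, u j ∈ selmerGroup (W.baseChange K) ((2 ^ L : ℕ) : ℤ) ∧
          conjAct W τ ((2 ^ L : ℕ) : ℤ) (u j) = (-W.rootNumber) • u j) →
        ∃ (n : ℕ) (_ : Squarefree n)
          (_ : ∀ ℓ ∈ n.primeFactors, Zhang2014.IsKolyvaginPrime (W.conductorNorm ℤ) W K 2 ℓ ∧ L ≤ Zhang2014.kolyvaginIndex W 2 ℓ)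
          (d : KolyvaginHeegnerData Dt β ι n),
          (∀ ℓ ∈ n.primeFactors, ∀ e : KolyvaginHeegnerData Dt β ι (n / ℓ),
            ((2 ^ (L - Mr (2 * m + 1)) : ℕ) : ℤ) • e.kolyvaginClass Nat.prime_two L = 0) ∧
          addOrderOf (d.kolyvaginClass Nat.prime_two L) = 2 ^ (L - Mr (2 * m + 2)) ∧
          -W.rootNumber * (-1) ^ n.primeFactors.card = -W.rootNumber ∧
          Disjoint (AddSubgroup.zmultiples (((2 ^ (L - Mr (2 * m + 1)) : ℕ) : ℤ) • d.kolyvaginClass Nat.prime_two L))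
            (AddSubgroup.closure (Set.range u) ⊔ AddSubgroup.zmultiples (d₁.kolyvaginClass Nat.prime_two L))) := by
  intro hP hQ2 hQ5R hCF W _ _ _ hcm hT v h2v hNv hmult hΔ K _ _ hIQ hodd h3 hHe hsq1 hsq2 hρ Dt β ι d₁ hy M₀ hdiv hndiv n d hn hKoly
    hPn Wd _ _ hTw hB _ τ hτ
  obtain ⟨n₀, e₀, hn₀, hn₀K, he₀⟩ := hWUP hP hQ2 hQ5R hCF W hcm hT v h2v hNv hmult hΔ K hIQ hodd h3 hHe hsq1 hsq2 hρ Dt β ι d₁ hy M₀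
    hdiv hndiv n d hn hKoly hPn Wd hTw hB
  have hρ' := MinimalTwinBSDTwo.forall_hasSurjectiveModNGaloisRep_two_pow_of_pos W hρ
  obtain ⟨R, Mr, h1, h2, h3', h4, h5⟩ := kolyvaginSuppliesAtTwo_of_grossWitness_onHabitat W hQ2 hcm hΔ hT hρ' hIQ hodd h3 hHe hsq1
    hsq2 h2v hNv hmult τ hτ Dt β ι d₁ M₀ hdiv hndiv (L := 2 * M₀ + 12) (k := 1) le_rfl le_rfl hn₀ hn₀K e₀ he₀
  exact ⟨2 * M₀ + 12, R, Mr, by omega, h1, h2, h3', h4, h5⟩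

end Summit.BirchSwinnertonDyer.BirchSwinnertonDyer.Theorems.GenusExact.PlusDescent

end
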